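import Summits.CriticalPhenomena.PercolationContinuityZ3.Theorems.PercNearOneGluingNoHeavyQuantGatedConvCone
import Summits.CriticalPhenomena.PercolationContinuityZ3.Theorems.PercNearOneGluingNoHeavyQuantFlowUncross
import HarnessLib

/-!
# QUANT lane R8, T-DEC: `LawDec.GatedConvClosedT` (the cone form of Conjecture E with FREE targets) IS FALSE — kernel refutation by an
# explicit pair with targets ABOVE the gated means (postcont-1 g83's witness G1) — and the REPAIRED cone form `GatedConvClosedTMean`
# (targets at or below the gated means), which still implies `GatedConvEmptyFree`

builds on p205010 (kernel theorem, internal audit signed; external expert review pending)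

Statement + support file (`--supports stmt-CriticalPhenomena-4575`), QUANT lane typer seat prim-quant-stmt (gen 25), rung R8 of
`run/shared/lean/prim/quant/LADDER.md`.  One `@[conjecture]` (`LawDec.GatedConvClosedTMean`), theorems with standard axioms, no sorries.
Continues `…QuantGatedConvCone` (typer g25, p317897: `@[conjecture] GatedConvClosedT`, `gatedConvEmptyFree_of_gatedConvClosedT`).

THE REFUTATION (witness found by prim-postcont-1 gen 83, `postcont/prim-postcont-1-g83/calc/gcc_cex83.py`, checked here in the kernel and
independently by the typer's exact LP `explore/dec.py`): `y = 1/2`, `q = 3/4`, `M₁ = 4`, `M₂ = 3`, `τ₁ = 2`, `τ₂ = 3/2` (the typed boundary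
`y·Mᵢ = τᵢ`, but ABOVE the gated means `q·mean μ₁ = 3/2`, `q·mean μ₂ = 5/4`), `j = 5`, `μ₁ = {1: 2/3, 4: 1/3}` (no atom at `0`),
`μ₂ = {1: 2/3, 3: 1/3}`.  `gate μ₁ q = {0: 1/4, 1: 1/2, 4: 1/4} = ½·δ₁ + ½·{0, 4; 1/2}` is DEC at target `2` at every layer of the window `{2,…,5}`
(`δ₁` self-sufficient since `2 ≤ 2·1`; the pair is giant-heavy at layers `2, 3` and a credit pair `4·½ = 2` at layers `4, 5`); `gate μ₂ q =
{0: 1/4, 1: 1/2, 3: 1/4} = ½·δ₁ + ½·{0, 3; 1/2}` is DEC at target `3/2` at every layer of `{1,…,5}`.  The conclusion law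
`gate (lconv μ₁ μ₂) q = {0: 1/4, 2: 1/3, 4: 1/6, 5: 1/6, 7: 1/12}` is NOT DEC(5) at target `7/2`, floor `1/2`: the low atom `0` (mass `1/4`) is
compatible only with the giant `7` (usage `1`) and the mids `5` (usage `7/3`) and `4` (usage `7`), which absorb at most `1/12 + 1/14 + 1/42 = 5/28
< 1/4`; the price system `α₀ = 1`, `β₄ = 1/7`, `β₅ = 3/7`, `β₆ = β₇ = 1` violates weak duality (`dual_le_of_decAtT`).
WHY IT FAILS / THE REPAIR.  postcont-1 g83's vertex census of the two gated-factor polytopes: 99 / 5 420 extreme pairs fail (Mᵢ ≤ 4), EVERY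
failure has `y < q < 1` and a target strictly above the gated mean `q·mean μᵢ`; with the extra binder `τᵢ ≤ q·Σ h·μᵢ h` there are 0 / 7 374
extreme pairs (828 cells) and 0 / 1 729 at the gated means exactly; the typer's kit j149372 (targets `∈ [5/12, 1]·q·mean`, 30 656 window-layer
instances / 0) never left that regime.  The repaired cone form `GatedConvClosedTMean` adds exactly this binder; the E-reduction feeds the gated
means (`τᵢ = q·Tᵢ`), so `GatedConvClosedTMean ⟹ GatedConvEmptyFree ⟹ (with ConvClosedT) SDECConvClosed / FarTreeRow` unchanged.
HONEST STATUS: `GatedConvClosedT` REFUTED (this file); `GatedConvClosedTMean`, `GatedConvEmptyFree`, `GatedShiftDEC`, `ConvClosedT`,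
`SDECConvClosed` OPEN.

* `gccμ₁`, `gccμ₂` (the witness laws), their law facts, `gcc_gate₁_eq` / `gcc_gate₂_eq` (the gated factors as two-component mixtures),
  `gcc_gate₁_decAtT` / `gcc_gate₂_decAtT` (hypotheses at every window layer), `gcc_law_eq` (the conclusion law), `gcc_not_decAtT` (weak duality);
  **`not_gatedConvClosedT : ¬ GatedConvClosedT`**.
* **`LawDec.GatedConvClosedTMean`** (`@[conjecture]`, repaired cone form); **`gatedConvEmptyFree_of_gatedConvClosedTMean`**;
  `sdecConvClosed_of_convClosedT_of_gatedConvClosedTMean`, `Quant.farTreeRow_of_convClosedT_of_gatedConvClosedTMean`.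

[this work]; witness: prim-postcont-1 gen 83 (this programme); flow normal form / weak duality: typer g22 (this lane).  The gluing rows served
[cite: KozmaNitzan2024, Conjecture 3 (p. 15)]; product measure [cite: Grimmett1999, §1.3 p. 10].
-/

noncomputable section

namespace Summit.CriticalPhenomena.PercolationContinuityZ3.Theorems

namespace Quant

open Finset

/-- the two-point law `{lo, hi; g}` (as in `…QuantLawDEC`) -/
local notation3 "TP[" lo ", " hi ", " g ", " h "]" =>
  (g : ℝ) * (if (h : ℕ) = (hi : ℕ) then (1 : ℝ) else 0) + (1 - (g : ℝ)) * (if (h : ℕ) = (lo : ℕ) then (1 : ℝ) else 0)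

namespace LawDec

/-! ### The witness -/

/-- the empty-free factor `μ₁ = {1: 2/3, 4: 1/3}`. [this work] -/
def gccμ₁ : ℕ → ℝ := fun h => if h = 1 then 2 / 3 else if h = 4 then 1 / 3 else 0

/-- the co-factor `μ₂ = {1: 2/3, 3: 1/3}`. [this work] -/
def gccμ₂ : ℕ → ℝ := fun h => if h = 1 then 2 / 3 else if h = 3 then 1 / 3 else 0

/-- `μ₁ ≥ 0`. [this work] -/
theorem gccμ₁_nonneg (h : ℕ) : 0 ≤ gccμ₁ h := by unfold gccμ₁; split_ifs <;> norm_num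
/-- `μ₂ ≥ 0`. [this work] -/
theorem gccμ₂_nonneg (h : ℕ) : 0 ≤ gccμ₂ h := by unfold gccμ₂; split_ifs <;> norm_num
/-- `μ₁` vanishes above `4`. [this work] -/
theorem gccμ₁_top (h : ℕ) (hh : 4 < h) : gccμ₁ h = 0 := by unfold gccμ₁; rw [if_neg (by omega), if_neg (by omega)]
/-- `μ₂` vanishes above `3`. [this work] -/
theorem gccμ₂_top (h : ℕ) (hh : 3 < h) : gccμ₂ h = 0 := by unfold gccμ₂; rw [if_neg (by omega), if_neg (by omega)]
/-- `μ₁` has mass `1`. [this work] -/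
theorem gccμ₁_sum : ∑ h ∈ Finset.range (4 + 1), gccμ₁ h = 1 := by
  simp only [Finset.sum_range_succ, Finset.sum_range_zero, gccμ₁]; norm_num
/-- `μ₂` has mass `1`. [this work] -/
theorem gccμ₂_sum : ∑ h ∈ Finset.range (3 + 1), gccμ₂ h = 1 := by
  simp only [Finset.sum_range_succ, Finset.sum_range_zero, gccμ₂]; norm_num

/-- `gate μ₁ (3/4) = ½·δ₁ + ½·{0, 4; 1/2}`. [this work] -/
theorem gcc_gate₁_eq : gate gccμ₁ (3 / 4) = fun h => (1 / 2 : ℝ) * TP[1, 1, (1 / 2 : ℝ), h] + (1 - 1 / 2) * TP[0, 4, (1 / 2 : ℝ), h] := by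
  funext h
  rw [gate_apply]
  unfold gccμ₁
  by_cases h0 : h = 0
  · subst h0; norm_num
  by_cases h1 : h = 1
  · subst h1; norm_num
  by_cases h4 : h = 4
  · subst h4; norm_num
  simp only [if_neg h1, if_neg h4, if_neg h0]; norm_num

/-- `gate μ₂ (3/4) = ½·δ₁ + ½·{0, 3; 1/2}`. [this work] -/
theorem gcc_gate₂_eq : gate gccμ₂ (3 / 4) = fun h => (1 / 2 : ℝ) * TP[1, 1, (1 / 2 : ℝ), h] + (1 - 1 / 2) * TP[0, 3, (1 / 2 : ℝ), h] := by
  funext h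
  rw [gate_apply]
  unfold gccμ₂
  by_cases h0 : h = 0
  · subst h0; norm_num
  by_cases h1 : h = 1
  · subst h1; norm_num
  by_cases h3 : h = 3
  · subst h3; norm_num
  simp only [if_neg h1, if_neg h3, if_neg h0]; norm_num

/-- the first gated factor is DEC at target `2` at EVERY layer (`δ₁` self-sufficient; the pair `{0,4;1/2}` giant-heavy below layer `4`, a credit
pair `4·½ = 2` from layer `4` on). [this work] -/
theorem gcc_gate₁_decAtT (j'' : ℕ) : DECAtT (1 / 2) 2 j'' 4 (gate gccμ₁ (3 / 4)) := by
  rw [gcc_gate₁_eq]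
  refine decAtT_mixture (1 / 2) (by norm_num) (by norm_num) ?_ ?_
  · exact decAtT_single (1 / 2) 2 j'' 4 1 1 (1 / 2) (by norm_num) le_rfl (by norm_num) (Or.inl ⟨rfl, Or.inl (by norm_num)⟩)
  · refine decAtT_single (1 / 2) 2 j'' 4 0 4 (1 / 2) (by norm_num) (by norm_num) le_rfl ?_
    by_cases hj : j'' + 1 ≤ 4
    · exact Or.inr (Or.inl ⟨by norm_num, hj, le_rfl⟩)
    · refine Or.inr (Or.inr ⟨by norm_num, by omega, ?_⟩)
      rw [if_pos le_rfl]; norm_num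

/-- the second gated factor is DEC at target `3/2` at EVERY layer. [this work] -/
theorem gcc_gate₂_decAtT (j'' : ℕ) : DECAtT (1 / 2) (3 / 2) j'' 3 (gate gccμ₂ (3 / 4)) := by
  rw [gcc_gate₂_eq]
  refine decAtT_mixture (1 / 2) (by norm_num) (by norm_num) ?_ ?_
  · exact decAtT_single (1 / 2) (3 / 2) j'' 3 1 1 (1 / 2) (by norm_num) le_rfl (by norm_num) (Or.inl ⟨rfl, Or.inl (by norm_num)⟩)
  · refine decAtT_single (1 / 2) (3 / 2) j'' 3 0 3 (1 / 2) (by norm_num) (by norm_num) le_rfl ?_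
    by_cases hj : j'' + 1 ≤ 3
    · exact Or.inr (Or.inl ⟨by norm_num, hj, le_rfl⟩)
    · refine Or.inr (Or.inr ⟨by norm_num, by omega, ?_⟩)
      rw [if_pos le_rfl]; norm_num

/-- the conclusion law: `gate (lconv μ₁ μ₂) (3/4) = {0: 1/4, 2: 1/3, 4: 1/6, 5: 1/6, 7: 1/12}`. [this work] -/
theorem gcc_law_eq (h : ℕ) :
    gate (lconv 4 3 gccμ₁ gccμ₂) (3 / 4) h =
      (if h = 0 then (1 / 4 : ℝ) else 0) + (if h = 2 then (1 / 3 : ℝ) else 0) + (if h = 4 then (1 / 6 : ℝ) else 0) +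
        (if h = 5 then (1 / 6 : ℝ) else 0) + (if h = 7 then (1 / 12 : ℝ) else 0) := by
  rw [gate_apply]
  simp only [lconv, Finset.sum_range_succ, Finset.sum_range_zero, gccμ₁, gccμ₂, zero_add]
  rcases Nat.lt_or_ge h 8 with hlt | hge
  · interval_cases h <;> norm_num
  · have hne : ∀ n : ℕ, n < 8 → (n = h) = False := fun n hn => by
      simp only [eq_iff_iff, iff_false]; omega
    have hne' : (h = 0) = False := by simp only [eq_iff_iff, iff_false]; omega
    have hne'' : ∀ n : ℕ, n < 8 → (h = n) = False := fun n hn => by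
      simp only [eq_iff_iff, iff_false]; omega
    simp [hne, hne', hne'']

/-- prices of the violating certificate: `α₀ = 1` on the only charged low atom. [this work] -/
def gccα : ℕ → ℝ := fun l => if l = 0 then 1 else 0

/-- prices of the violating certificate: `β₄ = 1/7`, `β₅ = 3/7`, `β ≡ 1` on the giants `h ≥ 6`. [this work] -/
def gccβ : ℕ → ℝ := fun h => if h = 4 then 1 / 7 else if h = 5 then 3 / 7 else if 6 ≤ h then 1 else 0

/-- **the conclusion law is NOT DEC(5) at floor `1/2`, target `7/2`**: weak duality with `(gccα, gccβ)` (feasible: giants usage `1 = 1·1`,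
mid `4` usage `7`, `1 = 7·(1/7)`, mid `5` usage `7/3`, `1 = (7/3)·(3/7)`) would give `1/4 ≤ 5/28`. [this work] -/
theorem gcc_not_decAtT : ¬ DECAtT (1 / 2) (2 + 3 / 2) 5 (4 + 3) (gate (lconv 4 3 gccμ₁ gccμ₂) (3 / 4)) := by
  intro hdec
  have key := dual_le_of_decAtT (1 / 2) (2 + 3 / 2) 5 (4 + 3) _ (by norm_num) (by norm_num) hdec
    gccα gccβ (fun h => by unfold gccβ; split_ifs <;> norm_num) ?_
  · revert key
    simp only [Finset.sum_range_succ, Finset.sum_range_zero, gcc_law_eq, gccα, gccβ]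
    norm_num
  · intro l h hl hlT hh hcomp
    by_cases hl0 : l = 0
    · subst hl0
      simp only [gccα, if_true]
      by_cases h6 : 6 ≤ h
      · have hu : usage (1 / 2) (2 + 3 / 2) 5 0 h = 1 := by
          simp only [usage, gateOf, if_pos h6]; norm_num
        rw [hu]; unfold gccβ; rw [if_neg (by omega), if_neg (by omega), if_pos h6]; norm_num
      · have hc : (2 + 3 / 2 : ℝ) < (0 : ℕ) + h := hcomp.resolve_left h6
        simp at hc
        have h45 : h = 4 ∨ h = 5 := by
          have : (4 : ℝ) ≤ h := by
            by_contra hlt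
            have : ((h : ℕ) : ℝ) ≤ 3 := by exact_mod_cast (by
              by_contra hle; exact hlt (by exact_mod_cast (by omega : 4 ≤ h)))
            linarith
          have h4 : 4 ≤ h := by exact_mod_cast this
          omega
        rcases h45 with rfl | rfl
        · simp only [gccβ, usage, gateOf, pairGate]
          norm_num [max_def]
        · simp only [gccβ, usage, gateOf, pairGate]
          norm_num [max_def]
    · simp only [gccα, if_neg hl0]
      have hlh : l < h := by
        rcases hcomp with h6 | hc
        · omega
        · by_contra hge
          have : (h : ℝ) ≤ l := by exact_mod_cast not_lt.1 hge
          have hl5 : (l : ℝ) ≤ 5 := by exact_mod_cast hl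
          linarith
      exact mul_nonneg (usage_pos_of_compat (1 / 2) (2 + 3 / 2) 5 l h (by norm_num) (by norm_num) hlT hlh hcomp).le
        (by unfold gccβ; split_ifs <;> norm_num)

/-- **`LawDec.GatedConvClosedT` IS FALSE** (witness above: all hypotheses hold, the conclusion fails at layer `5`). [this work] -/
theorem not_gatedConvClosedT : ¬ GatedConvClosedT := by
  intro hG
  have h := hG (1 / 2) (3 / 4) 2 (3 / 2) 4 3 5 gccμ₁ gccμ₂ (by norm_num) (by norm_num) (by norm_num) (by norm_num)
    gccμ₁_nonneg gccμ₁_top gccμ₁_sum gccμ₂_nonneg gccμ₂_top gccμ₂_sum (by unfold gccμ₁; norm_num) (by norm_num) (by norm_num)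
    (by norm_num) (fun j'' _ _ => gcc_gate₁_decAtT j'') (fun j'' _ _ => gcc_gate₂_decAtT j'')
  exact gcc_not_decAtT h

/-! ### The repaired cone form -/

/-- **CONJECTURE E IN CONE FORM, REPAIRED (`GatedConvClosedTMean`; typer g25 after postcont-1 g83).**  As `GatedConvClosedT` but with the targets
AT OR BELOW THE GATED MEANS: `τ₁ ≤ q·Σ h·μ₁ h`, `τ₂ ≤ q·Σ h·μ₂ h` (and still `y·Mᵢ ≤ τᵢ`).  For a floor `0 < y < 1`, a gate `y ≤ q ≤ 1`,
probability laws `μ₁` (NO atom at `0`) on `{0..M₁}` and `μ₂` on `{0..M₂}`, such targets, a layer `j < M₁ + M₂`: window-DEC of `gate μ₁ q` at `τ₁`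
and of `gate μ₂ q` at `τ₂` ⟹ `gate (lconv μ₁ μ₂) q` DEC(j) at `τ₁ + τ₂`.  EVIDENCE (exact): postcont-1 g83 vertex census of the gated-factor polytopes
with the mean binder: 0 / 7 374 extreme pairs (828 cells, Mᵢ ≤ 4; 462 cells at the boundary `τᵢ = y·Mᵢ`), 0 / 1 729 at the gated means; typer g25
kit j149372: 30 656 window-layer instances with `τᵢ ∈ [5/12, 1]·q·meanᵢ` / 0.  For fixed `q` the conclusion is affine in each factor, so a
vertex×vertex reduction holds (the mean row is linear).  Implies `GatedConvEmptyFree` (`gatedConvEmptyFree_of_gatedConvClosedTMean`).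
builds on p205010 (kernel theorem, internal audit signed; external expert review pending). [this work] [status: open] -/
@[conjecture] def GatedConvClosedTMean : Prop :=
  ∀ (y q τ₁ τ₂ : ℝ) (M₁ M₂ j : ℕ) (μ₁ μ₂ : ℕ → ℝ),
    0 < y → y < 1 → y ≤ q → q ≤ 1 →
    (∀ h, 0 ≤ μ₁ h) → (∀ h, M₁ < h → μ₁ h = 0) → (∑ h ∈ Finset.range (M₁ + 1), μ₁ h = 1) →
    (∀ h, 0 ≤ μ₂ h) → (∀ h, M₂ < h → μ₂ h = 0) → (∑ h ∈ Finset.range (M₂ + 1), μ₂ h = 1) →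
    μ₁ 0 = 0 → y * (M₁ : ℝ) ≤ τ₁ → y * (M₂ : ℝ) ≤ τ₂ →
    τ₁ ≤ q * ∑ h ∈ Finset.range (M₁ + 1), (h : ℝ) * μ₁ h → τ₂ ≤ q * ∑ h ∈ Finset.range (M₂ + 1), (h : ℝ) * μ₂ h →
    j < M₁ + M₂ →
    (∀ j'', j'' ≤ j → j ≤ j'' + M₂ → DECAtT y τ₁ j'' M₁ (gate μ₁ q)) →
    (∀ j'', j'' ≤ j → j ≤ j'' + M₁ → DECAtT y τ₂ j'' M₂ (gate μ₂ q)) →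
    DECAtT y (τ₁ + τ₂) j (M₁ + M₂) (gate (lconv M₁ M₂ μ₁ μ₂) q)

/-- **repaired cone form ⟹ E** (same proof as `gatedConvEmptyFree_of_gatedConvClosedT`: the E-reduction works at the gated means). [this work] -/
theorem gatedConvEmptyFree_of_gatedConvClosedTMean (hG : GatedConvClosedTMean) : GatedConvEmptyFree := by
  intro x Q M₁ M₂ μ₁ μ₂ hx0 hx1 hQ0 hQ1 hQx h10 h1M h11 hta1 h20 h2M h21 hta2 hz hS1 hS2 q hq0 hqQ j hj
  set T₁ : ℝ := ∑ h ∈ Finset.range (M₁ + 1), (h : ℝ) * μ₁ h with hT₁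
  set T₂ : ℝ := ∑ h ∈ Finset.range (M₂ + 1), (h : ℝ) * μ₂ h with hT₂
  have hq1 : q ≤ 1 := hqQ.trans hQ1
  have hy0 : 0 < q * x := mul_pos hq0 hx0
  have hy1 : q * x < 1 := lt_of_le_of_lt (mul_le_mul_of_nonneg_right hqQ hx0.le) hQx
  have hyq : q * x ≤ q := mul_le_of_le_one_right hq0.le hx1
  obtain ⟨n10, n1M, n11⟩ := gate_laws M₁ μ₁ q hq0.le hq1 h10 h1M h11
  obtain ⟨n20, n2M, n21⟩ := gate_laws M₂ μ₂ q hq0.le hq1 h20 h2M h21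
  have hmean1 : ∑ k ∈ Finset.range (M₁ + 1), (k : ℝ) * gate μ₁ q k = q * T₁ := sum_mul_gate μ₁ q M₁
  have hmean2 : ∑ k ∈ Finset.range (M₂ + 1), (k : ℝ) * gate μ₂ q k = q * T₂ := sum_mul_gate μ₂ q M₂
  have hall : ∀ (M : ℕ) (μ : ℕ → ℝ) (T : ℝ), (∀ h, 0 ≤ gate μ q h) → (∀ h, M < h → gate μ q h = 0) →
      (∑ h ∈ Finset.range (M + 1), gate μ q h = 1) → (∑ k ∈ Finset.range (M + 1), (k : ℝ) * gate μ q k = q * T) →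
      x * (M : ℝ) ≤ T → SDECUpTo x Q M μ → ∀ j'', DECAtT (q * x) (q * T) j'' M (gate μ q) := by
    intro M μ T g0 gM g1 gmean hta hS j''
    by_cases hlt : j'' < M
    · have := hS q hq0 hqQ j'' hlt
      rwa [decAt_iff_decAtT, gmean] at this
    · have hA := decAt_of_top_le M (gate μ q) g0 gM g1 (q * x) hy1 (fun h hh => ?_) j'' (not_lt.1 hlt)
      · rwa [decAt_iff_decAtT, gmean] at hA
      · have hhM : h ≤ M := by
          by_contra hc; exact absurd (gM h (not_le.1 hc)) (ne_of_gt hh)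
        rw [gmean]
        have : q * x * (h : ℝ) ≤ q * x * (M : ℝ) := mul_le_mul_of_nonneg_left (by exact_mod_cast hhM) hy0.le
        nlinarith
  have hconc := hG (q * x) q (q * T₁) (q * T₂) M₁ M₂ j μ₁ μ₂ hy0 hy1 hyq hq1 h10 h1M h11 h20 h2M h21 hz
    (by nlinarith) (by nlinarith) le_rfl le_rfl hj
    (fun j'' _ _ => hall M₁ μ₁ T₁ n10 n1M n11 hmean1 hta1 hS1 j'')
    (fun j'' _ _ => hall M₂ μ₂ T₂ n20 n2M n21 hmean2 hta2 hS2 j'')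
  have hτ : ∑ k ∈ Finset.range (M₁ + M₂ + 1), (k : ℝ) * gate (lconv M₁ M₂ μ₁ μ₂) q k = q * T₁ + q * T₂ := by
    rw [sum_mul_gate, sum_mul_lconv M₁ M₂ μ₁ μ₂ h11 h21]; ring
  rw [decAt_iff_decAtT, hτ]
  exact hconc

/-- **`ConvClosedT ∧ GatedConvClosedTMean ⟹ SDECConvClosed`.** [this work] -/
theorem sdecConvClosed_of_convClosedT_of_gatedConvClosedTMean (hC : ConvClosedT) (hG : GatedConvClosedTMean) : SDECConvClosed :=
  sdecConvClosed_of_convClosedT_of_gatedConvEmptyFree hC (gatedConvEmptyFree_of_gatedConvClosedTMean hG)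

end LawDec

/-- **`ConvClosedT ∧ GatedConvClosedTMean ⟹ Quant.FarTreeRow`.** CONDITIONAL result. [this work] -/
theorem farTreeRow_of_convClosedT_of_gatedConvClosedTMean (hC : LawDec.ConvClosedT) (hG : LawDec.GatedConvClosedTMean) : FarTreeRow :=
  farTreeRow_of_convClosedT_of_gatedConvEmptyFree hC (LawDec.gatedConvEmptyFree_of_gatedConvClosedTMean hG)

end Quant

end Summit.CriticalPhenomena.PercolationContinuityZ3.Theorems
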